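import Summits.CriticalPhenomena.PercolationContinuityZ3.Theorems.Transplant.FKConnectivityAllQDefs
import HarnessLib

/-!
# Connectivity correlation inequalities for every `q > 0` — file 2 of 3: `FourPoint ⇒` Kozma–Nitzan additive gluing and the
# pre-FKG inequality (3) for relay sets of size `≤ 2`, under ANY probability measure on the bond configurations of a finite vertex type

Support file (`--supports stmt-CriticalPhenomena-4575`), FK sub-lane `prim-bschramm-fk-1` (gen 4); builds on p205010 (kernel theorem,
internal audit signed; external expert review pending).  No named facts, no sorries; standard axioms.  See `…FKConnectivityAllQDefs.lean`
for the statements (`FourPointUnder`, `AdditiveGluingUnder`, `PreFKGPairUnder`, `FourPointFK`, `AdditiveGluingTwoFK`, the `…Pos`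
conjecture nodes) and the evidence.  Proved here: `additiveGluingUnder_pair_of_fourPoint`, `preFKGPairUnder_of_fourPoint`,
`additiveGluingUnder_of_card_le_two`, `additiveGluingTwoFK_of_fourPointFK`, `additiveGluingTwoFKPos_of` — the pattern bookkeeping of
Kozma–Nitzan's Theorem 1 (`x₇ − x₄`, `x₆ − x₃`), measure-generic.
[cite: KozmaNitzan2024, Conj. 1 (p. 3), eq. (3) (p. 3), Thm. 1 (pp. 7–8)]
-/

noncomputable section

namespace Summit.CriticalPhenomena.PercolationContinuityZ3.Theorems

namespace FK

open MeasureTheory Set Literature.Probability.LatticeModels Literature.Probability.Percolation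
open scoped Classical

variable {V : Type*}

/-! ### (2) `FourPoint ⇒` additive gluing and pre-FKG for two relay points (any probability measure, finite vertex type) -/

section Consequences

variable [Fintype V]

omit [Fintype V] in
/-- Pattern bookkeeping, inclusion 1: `((o↔a ∪ o↔c) ∖ o↔b) ∩ a↔b ⊆ {oc|ab}`. [cite: KozmaNitzan2024, proof of Thm. 1 (p. 7)] -/
theorem glue_diff_inter_subset_x7 (o a c b : V) :
    ((openConn o a ∪ openConn o c) \ openConn o b) ∩ openConn a b ⊆
      openConn o c ∩ openConn b a ∩ (sepEv a c : Set (BondConfig V)) := by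
  rintro ω ⟨⟨hU, hob⟩, hab⟩
  simp only [mem_openConn_iff', mem_union] at hU hob hab ⊢
  have hoa : ¬ (openGraph ω).Reachable o a := fun h => hob (h.trans hab)
  have hoc : (openGraph ω).Reachable o c := hU.resolve_left hoa
  refine ⟨⟨hoc, hab.symm⟩, ?_⟩
  rw [mem_sepEv_iff]
  exact fun hac => hob (hoc.trans (hac.symm.trans hab))

omit [Fintype V] in
/-- Pattern bookkeeping, inclusion 2: `{ocb|a} ⊆ (a↔b)ᶜ` and is disjoint from `(o↔a ∪ o↔c) ∖ o↔b`.
[cite: KozmaNitzan2024, proof of Thm. 1 (p. 7)] -/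
theorem x4_subset_compl (o a c b : V) :
    openConn o c ∩ openConn b c ∩ (sepEv a c : Set (BondConfig V)) ⊆
      (openConn a b)ᶜ \ ((openConn o a ∪ openConn o c) \ openConn o b) := by
  rintro ω ⟨⟨hoc, hbc⟩, hac⟩
  rw [mem_sepEv_iff] at hac
  simp only [mem_openConn_iff', mem_sdiff, mem_compl_iff, mem_union, not_and, not_not] at hoc hbc ⊢
  exact ⟨fun hab => hac (hab.trans hbc), fun _ => hoc.trans hbc.symm⟩

omit [Fintype V] in
/-- Every event of the finite configuration space is measurable. [folklore] -/
theorem measurableSet_bond (A : Set (BondConfig V)) [Finite V] : MeasurableSet A := by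
  haveI : Finite (Sym2 V) := inferInstance
  exact A.toFinite.measurableSet

/-- **Half of the gluing bound**: for a probability measure, `μ((o↔a ∪ o↔c) ∖ o↔b) − μ(a ↮ b) ≤ μ{oc|ab} − μ{ocb|a}`.
[cite: KozmaNitzan2024, proof of Thm. 1 (pp. 7–8)] -/
theorem glue_diff_le (μ : Measure (BondConfig V)) [IsFiniteMeasure μ] (o a c b : V) :
    μ.real ((openConn o a ∪ openConn o c) \ openConn o b) - μ.real (openConn a b)ᶜ ≤
      μ.real (openConn o c ∩ openConn b a ∩ sepEv a c) - μ.real (openConn o c ∩ openConn b c ∩ sepEv a c) := by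
  set F : Set (BondConfig V) := (openConn o a ∪ openConn o c) \ openConn o b
  have hmeas : MeasurableSet (openConn a b : Set (BondConfig V)) := measurableSet_bond _
  have hsplit : μ.real F = μ.real (F ∩ openConn a b) + μ.real (F \ openConn a b) :=
    (measureReal_inter_add_sdiff (μ := μ) (s := F) hmeas).symm
  have h1 : μ.real (F ∩ openConn a b) ≤ μ.real (openConn o c ∩ openConn b a ∩ sepEv a c) :=
    measureReal_mono (glue_diff_inter_subset_x7 o a c b)
  -- the two disjoint subsets `F ∖ (a↔b)` and `{ocb|a}` of `(a↔b)ᶜ`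
  have hdisj : Disjoint (F \ openConn a b) (openConn o c ∩ openConn b c ∩ sepEv a c) := by
    rw [Set.disjoint_left]
    intro ω hω hω'
    exact ((x4_subset_compl o a c b) hω').2 hω.1
  have hsub : (F \ openConn a b) ∪ (openConn o c ∩ openConn b c ∩ sepEv a c) ⊆ (openConn a b)ᶜ := by
    rintro ω (hω | hω)
    · exact hω.2
    · exact ((x4_subset_compl o a c b) hω).1
  have h2 : μ.real (F \ openConn a b) + μ.real (openConn o c ∩ openConn b c ∩ sepEv a c) ≤ μ.real (openConn a b)ᶜ := by
    rw [← measureReal_union hdisj (measurableSet_bond _)]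
    exact measureReal_mono hsub
  linarith

/-- **Four-point ⇒ additive gluing for the relay pair `{a, c}`** (any probability measure on the bond configurations of a finite
vertex type): if `μ{oa|cb} μ{oc|ab} ≤ μ{oab|c} μ{ocb|a}` then `μ(o ↔ b) ≥ μ(o ↔ {a, c}) − t` for every slack `t ≥ μ(a ↮ b), μ(c ↮ b)`.
Proof: `μ(o ↔ {a,c}) − μ(o ↔ b) ≤ μ(F)`, `F = (o↔a ∪ o↔c) ∖ o↔b`, and `μ(F) − μ(a ↮ b) ≤ x₇ − x₄`, `μ(F) − μ(c ↮ b) ≤ x₆ − x₃`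
(`glue_diff_le`); the four-point inequality forbids `x₇ > x₄ ∧ x₆ > x₃`. [cite: KozmaNitzan2024, Conj. 1 (p. 3) and Thm. 1 (p. 7)] -/
theorem additiveGluingUnder_pair_of_fourPoint (μ : Measure (BondConfig V)) [IsProbabilityMeasure μ] (o a c b : V)
    (h4 : FourPointUnder μ o a c b) : AdditiveGluingUnder μ ({a, c} : Finset V) o b := by
  intro t ht hA
  have hpair : (⋃ x ∈ ({a, c} : Finset V), (openConn o x : Set (BondConfig V))) = openConn o a ∪ openConn o c := by
    ext ω; simp [Finset.mem_insert, Finset.mem_singleton]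
  rw [hpair]
  set U : Set (BondConfig V) := openConn o a ∪ openConn o c
  set F : Set (BondConfig V) := U \ openConn o b
  -- `μ(U) ≤ μ(o↔b) + μ(F)`
  have hU : μ.real U ≤ μ.real (openConn o b) + μ.real F := by
    calc μ.real U ≤ μ.real (openConn o b ∪ F) := measureReal_mono (fun ω hω => by
            by_cases h : ω ∈ openConn o b
            · exact Or.inl h
            · exact Or.inr ⟨hω, h⟩)
      _ ≤ μ.real (openConn o b) + μ.real F := measureReal_union_le _ _
  -- slacks
  have hta : μ.real (openConn a b)ᶜ ≤ t := by
    have := hA a (by simp)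
    rw [measureReal_compl (measurableSet_bond _), probReal_univ]; linarith
  have htc : μ.real (openConn c b)ᶜ ≤ t := by
    have := hA c (by simp)
    rw [measureReal_compl (measurableSet_bond _), probReal_univ]; linarith
  -- the two half-bounds
  have ha := glue_diff_le μ o a c b
  have hc := glue_diff_le μ o c a b
  -- `hc` speaks about `(o↔c ∪ o↔a) ∖ o↔b`; rewrite to `F` and to the pattern events of `h4`
  have hUF : (openConn o c ∪ openConn o a) \ openConn o b = F := by
    show (openConn o c ∪ openConn o a) \ openConn o b = (openConn o a ∪ openConn o c) \ openConn o b
    rw [Set.union_comm]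
  rw [hUF, ← sepEv_comm a c] at hc
  unfold FourPointUnder at h4
  -- names
  set x₃ := μ.real (openConn o a ∩ openConn b a ∩ sepEv a c)
  set x₄ := μ.real (openConn o c ∩ openConn b c ∩ sepEv a c)
  set x₆ := μ.real (openConn o a ∩ openConn b c ∩ sepEv a c)
  set x₇ := μ.real (openConn o c ∩ openConn b a ∩ sepEv a c)
  have hx₃ : 0 ≤ x₃ := measureReal_nonneg
  have hx₄ : 0 ≤ x₄ := measureReal_nonneg
  have hx₆ : 0 ≤ x₆ := measureReal_nonneg
  have hx₇ : 0 ≤ x₇ := measureReal_nonneg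
  -- `ha : μ F - μ(a↔b)ᶜ ≤ x₇ - x₄`, `hc : μ F - μ(c↔b)ᶜ ≤ x₆ - x₃`
  have key : μ.real F ≤ t := by
    by_contra hF
    push Not at hF
    have h7 : x₄ < x₇ := by linarith
    have h6 : x₃ < x₆ := by linarith
    have : x₃ * x₄ < x₆ * x₇ := by nlinarith
    linarith
  linarith

/-- **Four-point ⇒ Kozma–Nitzan's pre-FKG inequality (3) for the relay pair `{a, c}`** (any probability measure, finite vertex type):
`μ(o ↔ b, o ↔ {a,c}) ≥ min (μ(o ↔ {a,c}, a ↔ b), μ(o ↔ {a,c}, c ↔ b))`.  Proof: the two differences are `x₇ − x₄` and `x₆ − x₃`.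
[cite: KozmaNitzan2024, eq. (3) (p. 3), Thm. 1 (p. 7)] -/
theorem preFKGPairUnder_of_fourPoint (μ : Measure (BondConfig V)) [IsFiniteMeasure μ] (o a c b : V)
    (h4 : FourPointUnder μ o a c b) : PreFKGPairUnder μ o a c b := by
  unfold PreFKGPairUnder
  unfold FourPointUnder at h4
  set U : Set (BondConfig V) := openConn o a ∪ openConn o c with hUdef
  -- decomposition of `U ∩ a↔b` and `U ∩ o↔b` along `o↔b` resp. `a↔b`
  have hm : ∀ A : Set (BondConfig V), MeasurableSet A := fun A => measurableSet_bond A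
  -- `U ∩ a↔b ∖ o↔b ⊆ {oc|ab}` and `U ∩ o↔b ∖ a↔b ⊇`?  We prove the two differences exactly.
  have hd₁ : μ.real (U ∩ openConn a b) - μ.real (U ∩ openConn o b) ≤
      μ.real (openConn o c ∩ openConn b a ∩ sepEv a c) - μ.real (openConn o c ∩ openConn b c ∩ sepEv a c) := by
    have e1 : μ.real (U ∩ openConn a b) =
        μ.real (U ∩ openConn a b ∩ openConn o b) + μ.real ((U ∩ openConn a b) \ openConn o b) :=
      (measureReal_inter_add_sdiff (μ := μ) (s := U ∩ openConn a b) (hm _)).symm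
    have e2 : μ.real (U ∩ openConn o b) =
        μ.real (U ∩ openConn o b ∩ openConn a b) + μ.real ((U ∩ openConn o b) \ openConn a b) :=
      (measureReal_inter_add_sdiff (μ := μ) (s := U ∩ openConn o b) (hm _)).symm
    have e3 : U ∩ openConn a b ∩ openConn o b = U ∩ openConn o b ∩ openConn a b := by
      ext ω; simp only [mem_inter_iff]; tauto
    have i1 : (U ∩ openConn a b) \ openConn o b ⊆ openConn o c ∩ openConn b a ∩ sepEv a c := by
      intro ω hω
      exact glue_diff_inter_subset_x7 o a c b ⟨⟨hω.1.1, hω.2⟩, hω.1.2⟩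
    have i2 : openConn o c ∩ openConn b c ∩ sepEv a c ⊆ (U ∩ openConn o b) \ openConn a b := by
      rintro ω ⟨⟨hoc, hbc⟩, hac⟩
      rw [mem_sepEv_iff] at hac
      simp only [hUdef, mem_sdiff, mem_inter_iff, mem_union, mem_openConn_iff'] at hoc hbc ⊢
      exact ⟨⟨Or.inr hoc, hoc.trans hbc.symm⟩, fun hab => hac (hab.trans hbc)⟩
    have m1 := measureReal_mono (μ := μ) i1
    have m2 := measureReal_mono (μ := μ) i2
    rw [e1, e2, e3]; linarith
  have hd₂ : μ.real (U ∩ openConn c b) - μ.real (U ∩ openConn o b) ≤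
      μ.real (openConn o a ∩ openConn b c ∩ sepEv a c) - μ.real (openConn o a ∩ openConn b a ∩ sepEv a c) := by
    have e1 : μ.real (U ∩ openConn c b) =
        μ.real (U ∩ openConn c b ∩ openConn o b) + μ.real ((U ∩ openConn c b) \ openConn o b) :=
      (measureReal_inter_add_sdiff (μ := μ) (s := U ∩ openConn c b) (hm _)).symm
    have e2 : μ.real (U ∩ openConn o b) =
        μ.real (U ∩ openConn o b ∩ openConn c b) + μ.real ((U ∩ openConn o b) \ openConn c b) :=
      (measureReal_inter_add_sdiff (μ := μ) (s := U ∩ openConn o b) (hm _)).symm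
    have e3 : U ∩ openConn c b ∩ openConn o b = U ∩ openConn o b ∩ openConn c b := by
      ext ω; simp only [mem_inter_iff]; tauto
    have i1 : (U ∩ openConn c b) \ openConn o b ⊆ openConn o a ∩ openConn b c ∩ sepEv a c := by
      intro ω hω
      have hU' : ω ∈ (openConn o c ∪ openConn o a : Set (BondConfig V)) := by
        rcases hω.1.1 with h | h
        · exact Or.inr h
        · exact Or.inl h
      have := glue_diff_inter_subset_x7 o c a b ⟨⟨hU', hω.2⟩, hω.1.2⟩
      rw [← sepEv_comm a c] at this
      exact this
    have i2 : openConn o a ∩ openConn b a ∩ sepEv a c ⊆ (U ∩ openConn o b) \ openConn c b := by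
      rintro ω ⟨⟨hoa, hba⟩, hac⟩
      rw [mem_sepEv_iff] at hac
      simp only [hUdef, mem_sdiff, mem_inter_iff, mem_union, mem_openConn_iff'] at hoa hba ⊢
      exact ⟨⟨Or.inl hoa, hoa.trans hba.symm⟩, fun hcb => hac (hba.symm.trans hcb.symm)⟩
    have m1 := measureReal_mono (μ := μ) i1
    have m2 := measureReal_mono (μ := μ) i2
    rw [e1, e2, e3]; linarith
  set x₃ := μ.real (openConn o a ∩ openConn b a ∩ sepEv a c)
  set x₄ := μ.real (openConn o c ∩ openConn b c ∩ sepEv a c)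
  set x₆ := μ.real (openConn o a ∩ openConn b c ∩ sepEv a c)
  set x₇ := μ.real (openConn o c ∩ openConn b a ∩ sepEv a c)
  have hx₃ : 0 ≤ x₃ := measureReal_nonneg
  have hx₄ : 0 ≤ x₄ := measureReal_nonneg
  have hx₆ : 0 ≤ x₆ := measureReal_nonneg
  have hx₇ : 0 ≤ x₇ := measureReal_nonneg
  by_contra hmin
  push Not at hmin
  rw [lt_min_iff] at hmin
  have h7 : x₄ < x₇ := by linarith [hmin.1]
  have h6 : x₃ < x₆ := by linarith [hmin.2]
  have : x₃ * x₄ < x₆ * x₇ := by nlinarith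
  linarith

/-- **Additive gluing for a single relay point** is the union bound (any probability measure). [cite: KozmaNitzan2024, p. 3 (|A| = 1)] -/
theorem additiveGluingUnder_singleton (μ : Measure (BondConfig V)) [IsProbabilityMeasure μ] (o a b : V) :
    AdditiveGluingUnder μ ({a} : Finset V) o b := by
  intro t ht hA
  have hta : μ.real (openConn a b)ᶜ ≤ t := by
    have := hA a (by simp)
    rw [measureReal_compl (measurableSet_bond _), probReal_univ]; linarith
  have hU : (⋃ x ∈ ({a} : Finset V), (openConn o x : Set (BondConfig V))) = openConn o a := by
    ext ω; simp
  rw [hU]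
  have hsub : (openConn o a : Set (BondConfig V)) ⊆ openConn o b ∪ (openConn a b)ᶜ := by
    intro ω hoa
    by_cases hab : ω ∈ openConn a b
    · exact Or.inl (show (openGraph ω).Reachable o b from (show (openGraph ω).Reachable o a from hoa).trans hab)
    · exact Or.inr hab
  have := (measureReal_mono (μ := μ) hsub).trans (measureReal_union_le _ _)
  linarith

omit [Fintype V] in
/-- **Additive gluing for the empty relay set** is trivial. [folklore] -/
theorem additiveGluingUnder_empty (μ : Measure (BondConfig V)) [IsProbabilityMeasure μ] (o b : V) :
    AdditiveGluingUnder μ (∅ : Finset V) o b := by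
  intro t ht _
  simp only [Finset.notMem_empty, Set.iUnion_of_empty, Set.iUnion_empty, measureReal_empty]
  linarith [measureReal_nonneg (μ := μ) (s := openConn o b)]

/-- **Four-point at every pair ⇒ additive gluing for every relay set with at most two points** (any probability measure).
[cite: KozmaNitzan2024, Conj. 1 (p. 3), Thm. 1 (p. 7)] -/
theorem additiveGluingUnder_of_card_le_two (μ : Measure (BondConfig V)) [IsProbabilityMeasure μ] (o b : V)
    (h4 : ∀ a c : V, FourPointUnder μ o a c b) (A : Finset V) (hA : A.card ≤ 2) : AdditiveGluingUnder μ A o b := by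
  rcases Nat.lt_or_ge A.card 1 with h0 | h1
  · have hA0 : A.card = 0 := by omega
    have : A = ∅ := Finset.card_eq_zero.mp hA0
    subst this; exact additiveGluingUnder_empty μ o b
  rcases Nat.lt_or_ge A.card 2 with h1' | h2
  · have hA1 : A.card = 1 := by omega
    obtain ⟨a, rfl⟩ := Finset.card_eq_one.mp hA1
    exact additiveGluingUnder_singleton μ o a b
  · have hA2 : A.card = 2 := by omega
    obtain ⟨a, c, -, rfl⟩ := Finset.card_eq_two.mp hA2
    exact additiveGluingUnder_pair_of_fourPoint μ o a c b (h4 a c)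

end Consequences

/-! ### The `q`-family consequences -/

/-- **`FourPoint ⇒ AdditiveGluingTwo` for `φ_{w,q}`**, any `q > 0`. [cite: KozmaNitzan2024, Conj. 1 (p. 3), Thm. 1 (p. 7)] -/
theorem additiveGluingTwoFK_of_fourPointFK {q : ℝ} (hq : 0 < q) (h : FourPointFK q) : AdditiveGluingTwoFK q := by
  intro n w A o b hA
  haveI := isProbabilityMeasure_rcMeasureW w hq (∅ : Set (Fin n))
  exact additiveGluingUnder_of_card_le_two _ o b (fun a c => h n w o a c b) A hA

/-- The implication between the conjecture nodes: four-point gives two-point additive gluing. [cite: KozmaNitzan2024, Thm. 1 (p. 7)] -/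
theorem additiveGluingTwoFKPos_of (h : FourPointFKPos) : AdditiveGluingTwoFKPos :=
  fun q hq => additiveGluingTwoFK_of_fourPointFK hq (h q hq)

end FK

end Summit.CriticalPhenomena.PercolationContinuityZ3.Theorems

end
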